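import Mathlib
import Summits.NavierStokesRegularity.NavierStokesRegularity.Theorems.ThreadingFluxHorizonTowerFourthDigit
import HarnessLib

/-!
# Crux `PoloidalLiouville` (stmt-NavierStokesRegularity-1222), crux idea «horizon-threading-tower» (ns-idea-15):
# THE FOURTH CONE DIGIT, II — the brackets of the class identity to SECOND order in `ρ`

Support file (`--supports stmt-NavierStokesRegularity-1222`, helper; cell `ns-wall-extremal`, width hand ns-wall-eng-3 g7; 0 kit), toward
THM K (`FiniteTowerGcdTwoTwoShellsHorizonTowerZonality`).  THM J (`…ThirdDigit`) read every bracket of the class identity modulo `ρ`;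
the fourth digit needs the `ρ¹`-coefficient as well.  With the top remainders `(8j+14)G = A·L^jM − ρΔG`, the confined competitor
`P_c′ = κ₀L^{m+1} + κ₁L^mM + ρG_c` (harmonic) and the confined `D′−4` shell `P_b′ = a₀L^kM² + b₀L^{k+1}M + γL^{k+2} + ρG_b` (harmonic),
everything multiplied by the power of `L` that clears natural subtraction and by the remainder denominators
(`f = 16j+20`, `h = 24j+18`, `d₁ = 8m+6`, `d₂ = 16m+4`, `q = 8j+14`, `p_b = 8k+14`), each statement is `… = X₀ + ρ·X₁ + ρ²·J` with
`X₀, X₁` explicit in `L, M, W, τ, δ`: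
* `genL_cube_mul_detP_of_sq_mul`: `L²Y = R ⇒ L³{X,Y} = L{X,R} − 2R{X,L}` (how `Δ(L^jM)` enters brackets);
* ★ `exists_detP_genL_lapP_remainder₂`: `f h·L⁴{L,ΔG}`;  ★ `exists_detP_remainders₂`: `q₁q₂f₁f₂·L³{G₁,G₂}`;
* ★ `exists_detP_genL_competitorRemainder₂`: `d₁d₂·L⁴{G_c,L}` (`{P_c′,G₂}` to second order is in part III, `…FourthDigitCompetitor`);
* `exists_detP_competitor_top₂`: `q₁d₁·L²{P_c′,P_{D′}}`;
* `exists_detP_genL_bShellRemainder`: `p_b·L²{G_b,L}` (mod `ρ`);  `exists_detP_bShell_remainder`: `q·L{P_b′,G₂}` (mod `ρ`);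
  `detP_bShell_genL`: `{a₀L^kM² + b₀L^{k+1}M + γL^{k+2}, L} = −8a₀L^kMW − 4b₀L^{k+1}W`.
Every closed form was first checked by the seat's exact reduced-algebra CAS against full harmonic projections (check_K3.py).

HONEST LABEL: polynomial algebra about one crux idea's typed objects; no Prop of the sketch is closed here; `HorizonTowerZonality`
(general towers), `PoloidalLiouville` (1222) OPEN; NS regularity NOT proved.  [folklore]
-/

-- the summit and its single sub-problem share the name (CONVENTIONS §1)
set_option linter.dupNamespace false
-- `simp only` closers over `C`-coefficients are import-order sensitive (simprocs); keep the lists explicit, silence the arg linter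
set_option linter.unusedSimpArgs false

noncomputable section

open MvPolynomial

namespace Summit.NavierStokesRegularity.NavierStokesRegularity.Theorems.PoloidalLiouville.HorizonTower.Zonal

section Real

variable (a b d e f : ℝ)

/-- `L²Y = R ⇒ L³{X,Y} = L{X,R} − 2R{X,L}`. [folklore] -/
theorem genL_cube_mul_detP_of_sq_mul (P Y R : RPoly) (h : genL a b d e f ^ 2 * Y = R) :
    genL a b d e f ^ 3 * detP P Y = genL a b d e f * detP P R - C 2 * R * detP P (genL a b d e f) := by
  have h1 : detP P (genL a b d e f ^ 2 * Y) = genL a b d e f ^ 2 * detP P Y + Y * detP P (genL a b d e f ^ 2) :=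
    detP_mul_right _ _ _
  rw [h] at h1
  rw [pow_two, detP_mul_right] at h1
  simp only [map_ofNat]
  linear_combination (-(genL a b d e f)) * h1 + (-(2 * detP P (genL a b d e f))) * h

/-- The third remainder in a general exponent `j ≥ 1` (`…FourthDigit`, `lapP_lapP_remainder`). [folklore] -/
theorem lapP_lapP_remainder' {G : RPoly} {A : ℝ} {j : ℕ} (hj : 1 ≤ j) (hG : G.IsHomogeneous (2 * j + 2))
    (h : C (8 * (j : ℝ) + 14) * G = C A * genL a b d e f ^ j * genM a b d e f - normSq * lapP G) :
    C (24 * (j : ℝ) + 18) * lapP (lapP G)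
      = C A * lapP (lapP (genL a b d e f ^ j * genM a b d e f)) - normSq * lapP (lapP (lapP G)) := by
  obtain ⟨i, rfl⟩ : ∃ i, j = i + 1 := ⟨j - 1, by omega⟩
  have hG' : G.IsHomogeneous (2 * i + 4) := by rwa [show 2 * (i + 1) + 2 = 2 * i + 4 by ring] at hG
  have h' : C (8 * (i : ℝ) + 22) * G = C A * genL a b d e f ^ (i + 1) * genM a b d e f - normSq * lapP G := by
    rw [← h]; push_cast; ring_nf
  have h2 := lapP_lapP_remainder a b d e f hG' h'
  rw [← h2]; push_cast; ring_nf

/-- ★ `{L, ΔG}` to SECOND order for a top remainder `(8j+14)G = A·L^jM − ρΔG` (`j ≥ 1`):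
`(16j+20)(24j+18)·L⁴{L,ΔG} = 32(24j+18)A·j(j−1)·L^{j+2}MW − ρ·A·(192j(j−1)(j−2)(j−3)·L^jM²W + 96j(j−1)(2j−1)τ·L^{j+2}W) + ρ²J`.
[folklore] -/
theorem exists_detP_genL_lapP_remainder₂ {G : RPoly} {A : ℝ} {j : ℕ} (hj : 1 ≤ j) (hG : G.IsHomogeneous (2 * j + 2))
    (h : C (8 * (j : ℝ) + 14) * G = C A * genL a b d e f ^ j * genM a b d e f - normSq * lapP G) :
    ∃ J : RPoly, C ((16 * (j : ℝ) + 20) * (24 * (j : ℝ) + 18)) * (genL a b d e f ^ 4 * detP (genL a b d e f) (lapP G))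
      = C (32 * (24 * (j : ℝ) + 18) * A * j * ((j : ℝ) - 1)) * genL a b d e f ^ (j + 2) * genM a b d e f * genW a b d e f
        - normSq * (C (192 * A * j * ((j : ℝ) - 1) * ((j : ℝ) - 2) * ((j : ℝ) - 3)) * genL a b d e f ^ j * genM a b d e f ^ 2 * genW a b d e f
          + C (96 * A * j * ((j : ℝ) - 1) * (2 * (j : ℝ) - 1) * genTau a b d e f) * genL a b d e f ^ (j + 2) * genW a b d e f)
        + normSq ^ 2 * J := by
  have e1 := congrArg (detP (genL a b d e f)) (lapP_remainder a b d e f hG h)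
  have e2 := congrArg (detP (genL a b d e f)) (lapP_lapP_remainder' a b d e f hj hG h)
  rw [detP_C_mul_right, detP_sub_right, detP_C_mul_right, detP_normSq_mul_right'] at e1 e2
  have x1 := genL_sq_mul_detP_lapP_genL_pow_mul_genM_genL a b d e f j
  rw [detP_antisymm] at x1
  have h4 : genL a b d e f ^ 4 * lapP (lapP (genL a b d e f ^ j * genM a b d e f))
      = C (16 * (j : ℝ) * ((j : ℝ) - 1) * ((j : ℝ) - 2) * ((j : ℝ) - 3)) * (genL a b d e f ^ j * genM a b d e f ^ (2 + 1))
        + C (24 * (j : ℝ) * ((j : ℝ) - 1) * (2 * (j : ℝ) - 1) * genTau a b d e f) * (genL a b d e f ^ (j + 2) * genM a b d e f ^ (0 + 1))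
        + C (48 * (j : ℝ) * (2 * (j : ℝ) - 1) * genDelta a b d e f) * genL a b d e f ^ (j + 3)
        + C (96 * (j : ℝ) * ((j : ℝ) - 1) * ((j : ℝ) - 2) * genDelta a b d e f) * (normSq * (genL a b d e f ^ (j + 1) * genM a b d e f ^ (0 + 1))) := by
    rw [genL_pow_four_mul_lapP_lapP_genL_pow_mul_genM]; ring
  have x2 : detP (genL a b d e f) (genL a b d e f ^ 4 * lapP (lapP (genL a b d e f ^ j * genM a b d e f))) = genL a b d e f ^ 4 * detP (genL a b d e f) (lapP (lapP (genL a b d e f ^ j * genM a b d e f))) := by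
    rw [detP_mul_right, detP_pow_self, mul_zero, add_zero]
  rw [h4, detP_add_right, detP_add_right, detP_add_right, detP_C_mul_right, detP_C_mul_right, detP_C_mul_right, detP_C_mul_right,
    detP_genL_genL_pow_mul_genM_pow, detP_genL_genL_pow_mul_genM_pow, detP_pow_self, detP_normSq_mul_right',
    detP_genL_genL_pow_mul_genM_pow] at x2
  refine ⟨genL a b d e f ^ 4 * detP (genL a b d e f) (lapP (lapP (lapP G)))
    - C (384 * A * j * ((j : ℝ) - 1) * ((j : ℝ) - 2) * genDelta a b d e f) * genL a b d e f ^ (j + 1) * genW a b d e f, ?_⟩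
  simp only [map_mul, map_add, map_sub, map_natCast, map_ofNat, map_one, Nat.cast_add, Nat.cast_ofNat, pow_zero, mul_one] at e1 e2 x1 x2 ⊢
  linear_combination ((24 * (j : RPoly) + 18) * genL a b d e f ^ 4) * e1 - (normSq * genL a b d e f ^ 4) * e2
    - ((24 * (j : RPoly) + 18) * C A * genL a b d e f ^ 2) * x1 + (normSq * C A) * x2

/-- ★ `{G₁, G₂}` to SECOND order for two top remainders (`m, n ≥ 1`):
`q₁q₂f₁f₂·L³{G₁,G₂} = 4(m−n)f₁f₂A₁A₂·L^{m+n+2}MW − ρ·A₁A₂·(f₁(−4n(4n+2)τL^{m+n+2} + 16n(n−1)(2m−n+2)L^{m+n}M²)`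
`− f₂(−4m(4m+2)τL^{m+n+2} + 16m(m−1)(2n−m+2)L^{m+n}M²))W + ρ²J` (`q = 8·+14`, `f = 16·+20`). [folklore] -/
theorem exists_detP_remainders₂ {G₁ G₂ : RPoly} {A₁ A₂ : ℝ} {m n : ℕ}
    (hG₁ : G₁.IsHomogeneous (2 * m + 2)) (hG₂ : G₂.IsHomogeneous (2 * n + 2))
    (h₁ : C (8 * (m : ℝ) + 14) * G₁ = C A₁ * genL a b d e f ^ m * genM a b d e f - normSq * lapP G₁)
    (h₂ : C (8 * (n : ℝ) + 14) * G₂ = C A₂ * genL a b d e f ^ n * genM a b d e f - normSq * lapP G₂) :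
    ∃ J : RPoly, C ((8 * (m : ℝ) + 14) * (8 * (n : ℝ) + 14) * (16 * (m : ℝ) + 20) * (16 * (n : ℝ) + 20)) * (genL a b d e f ^ 3 * detP G₁ G₂)
      = C (4 * ((m : ℝ) - n) * (16 * (m : ℝ) + 20) * (16 * (n : ℝ) + 20) * A₁ * A₂) * genL a b d e f ^ (m + n + 2) * genM a b d e f * genW a b d e f
        - normSq * (C (A₁ * A₂) * ((16 * (m : RPoly) + 20) * (-(C (4 * (n : ℝ) * (4 * (n : ℝ) + 2) * genTau a b d e f)) * genL a b d e f ^ (m + n + 2)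
              + C (16 * (n : ℝ) * ((n : ℝ) - 1) * (2 * (m : ℝ) - n + 2)) * genL a b d e f ^ (m + n) * genM a b d e f ^ 2)
            - (16 * (n : RPoly) + 20) * (-(C (4 * (m : ℝ) * (4 * (m : ℝ) + 2) * genTau a b d e f)) * genL a b d e f ^ (m + n + 2)
              + C (16 * (m : ℝ) * ((m : ℝ) - 1) * (2 * (n : ℝ) - m + 2)) * genL a b d e f ^ (m + n) * genM a b d e f ^ 2)) * genW a b d e f)
        + normSq ^ 2 * J := by
  -- the remainder relations and their Laplacians
  have f₁ := lapP_remainder a b d e f hG₁ h₁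
  have f₂ := lapP_remainder a b d e f hG₂ h₂
  have R₁ := genL_sq_mul_lapP_genL_pow_mul_genM a b d e f m   -- L² Δ(L^m M)
  have R₂ := genL_sq_mul_lapP_genL_pow_mul_genM a b d e f n   -- L² Δ(L^n M)
  -- `L³{L^m M, Δ(L^n M)}` and `L³{L^n M, Δ(L^m M)}` through `genL_cube_mul_detP_of_sq_mul`
  have c₁ := genL_cube_mul_detP_of_sq_mul a b d e f (genL a b d e f ^ m * genM a b d e f) _ _ R₂
  have c₂ := genL_cube_mul_detP_of_sq_mul a b d e f (genL a b d e f ^ n * genM a b d e f) _ _ R₁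
  -- the explicit brackets
  have bLM : detP (genL a b d e f ^ m * genM a b d e f) (genL a b d e f) = -(C 4 * genL a b d e f ^ m * genW a b d e f) := detP_genL_pow_mul_genM_genL a b d e f m
  have bLN : detP (genL a b d e f ^ n * genM a b d e f) (genL a b d e f) = -(C 4 * genL a b d e f ^ n * genW a b d e f) := detP_genL_pow_mul_genM_genL a b d e f n
  have R₂' : C ((4 * (n : ℝ) + 2) * genTau a b d e f) * genL a b d e f ^ (n + 2) + C (4 * (n : ℝ) * ((n : ℝ) - 1)) * genL a b d e f ^ n * genM a b d e f ^ 2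
      + C (8 * (n : ℝ) * genDelta a b d e f) * normSq * genL a b d e f ^ (n + 1)
      = C ((4 * (n : ℝ) + 2) * genTau a b d e f) * genL a b d e f ^ (n + 2) + C (4 * (n : ℝ) * ((n : ℝ) - 1)) * (genL a b d e f ^ n * genM a b d e f ^ (1 + 1))
      + C (8 * (n : ℝ) * genDelta a b d e f) * (normSq * genL a b d e f ^ (n + 1)) := by ring
  have R₁' : C ((4 * (m : ℝ) + 2) * genTau a b d e f) * genL a b d e f ^ (m + 2) + C (4 * (m : ℝ) * ((m : ℝ) - 1)) * genL a b d e f ^ m * genM a b d e f ^ 2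
      + C (8 * (m : ℝ) * genDelta a b d e f) * normSq * genL a b d e f ^ (m + 1)
      = C ((4 * (m : ℝ) + 2) * genTau a b d e f) * genL a b d e f ^ (m + 2) + C (4 * (m : ℝ) * ((m : ℝ) - 1)) * (genL a b d e f ^ m * genM a b d e f ^ (1 + 1))
      + C (8 * (m : ℝ) * genDelta a b d e f) * (normSq * genL a b d e f ^ (m + 1)) := by ring
  have d₁ : genL a b d e f * detP (genL a b d e f ^ m * genM a b d e f) (C ((4 * (n : ℝ) + 2) * genTau a b d e f) * genL a b d e f ^ (n + 2) + C (4 * (n : ℝ) * ((n : ℝ) - 1)) * genL a b d e f ^ n * genM a b d e f ^ 2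
      + C (8 * (n : ℝ) * genDelta a b d e f) * normSq * genL a b d e f ^ (n + 1))
      = C ((4 * (n : ℝ) + 2) * genTau a b d e f) * (genL a b d e f * detP (genL a b d e f ^ m * genM a b d e f ^ (0 + 1)) (genL a b d e f ^ (n + 2)))
        + C (4 * (n : ℝ) * ((n : ℝ) - 1)) * (genL a b d e f * detP (genL a b d e f ^ m * genM a b d e f ^ (0 + 1)) (genL a b d e f ^ n * genM a b d e f ^ (1 + 1)))
        + C (8 * (n : ℝ) * genDelta a b d e f) * normSq * (genL a b d e f * detP (genL a b d e f ^ m * genM a b d e f ^ (0 + 1)) (genL a b d e f ^ (n + 1))) := by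
    rw [R₂', detP_add_right, detP_add_right, detP_C_mul_right, detP_C_mul_right, detP_C_mul_right, detP_normSq_mul_right', zero_add,
      pow_one]
    ring
  have d₂ : genL a b d e f * detP (genL a b d e f ^ n * genM a b d e f) (C ((4 * (m : ℝ) + 2) * genTau a b d e f) * genL a b d e f ^ (m + 2) + C (4 * (m : ℝ) * ((m : ℝ) - 1)) * genL a b d e f ^ m * genM a b d e f ^ 2
      + C (8 * (m : ℝ) * genDelta a b d e f) * normSq * genL a b d e f ^ (m + 1))
      = C ((4 * (m : ℝ) + 2) * genTau a b d e f) * (genL a b d e f * detP (genL a b d e f ^ n * genM a b d e f ^ (0 + 1)) (genL a b d e f ^ (m + 2)))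
        + C (4 * (m : ℝ) * ((m : ℝ) - 1)) * (genL a b d e f * detP (genL a b d e f ^ n * genM a b d e f ^ (0 + 1)) (genL a b d e f ^ m * genM a b d e f ^ (1 + 1)))
        + C (8 * (m : ℝ) * genDelta a b d e f) * normSq * (genL a b d e f * detP (genL a b d e f ^ n * genM a b d e f ^ (0 + 1)) (genL a b d e f ^ (m + 1))) := by
    rw [R₁', detP_add_right, detP_add_right, detP_C_mul_right, detP_C_mul_right, detP_C_mul_right, detP_normSq_mul_right', zero_add,
      pow_one]
    ring
  rw [genL_mul_detP_genL_pow_mul_genM_pow_genL_pow, genL_mul_detP_genL_pow_mul_genM_pow, genL_mul_detP_genL_pow_mul_genM_pow_genL_pow] at d₁ d₂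
  have k12 := genL_sq_mul_detP_genL_pow_mul_genM a b d e f m n   -- L²{L^mM, L^nM}
  -- `{G₁,G₂}` expanded through the remainder relations: `q₁q₂{G₁,G₂} = {A₁L^mM − ρΔG₁, A₂L^nM − ρΔG₂}`
  have h₁' : C (8 * (m : ℝ) + 14) * G₁ = C A₁ * (genL a b d e f ^ m * genM a b d e f) - normSq * lapP G₁ := by rw [h₁]; ring
  have h₂' : C (8 * (n : ℝ) + 14) * G₂ = C A₂ * (genL a b d e f ^ n * genM a b d e f) - normSq * lapP G₂ := by rw [h₂]; ring
  have hexp : C ((8 * (m : ℝ) + 14) * (8 * (n : ℝ) + 14)) * detP G₁ G₂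
      = detP (C A₁ * (genL a b d e f ^ m * genM a b d e f) - normSq * lapP G₁) (C A₂ * (genL a b d e f ^ n * genM a b d e f) - normSq * lapP G₂) := by
    rw [← h₁', ← h₂', detP_C_mul_left, detP_C_mul_right, map_mul]; ring
  rw [detP_sub_left, detP_sub_right, detP_sub_right, detP_C_mul_left, detP_C_mul_left, detP_C_mul_right, detP_C_mul_right,
    detP_normSq_mul_left', detP_normSq_mul_left', detP_normSq_mul_right', detP_normSq_mul_right'] at hexp
  -- the first-order brackets of the Laplacians: `f₂{L^mM, ΔG₂} = A₂{L^mM, Δ(L^nM)} − ρ{L^mM, Δ²G₂}` etc.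
  have g₁ := congrArg (detP (genL a b d e f ^ m * genM a b d e f)) f₂
  have g₂ := congrArg (detP (genL a b d e f ^ n * genM a b d e f)) f₁
  rw [detP_C_mul_right, detP_sub_right, detP_C_mul_right, detP_normSq_mul_right'] at g₁ g₂
  refine ⟨(16 * (m : RPoly) + 20) * (16 * (n : RPoly) + 20) * genL a b d e f ^ 3 * detP (lapP G₁) (lapP G₂)
    + C A₁ * (16 * (m : RPoly) + 20) * genL a b d e f ^ 3 * detP (genL a b d e f ^ m * genM a b d e f) (lapP (lapP G₂))
    - C A₂ * (16 * (n : RPoly) + 20) * genL a b d e f ^ 3 * detP (genL a b d e f ^ n * genM a b d e f) (lapP (lapP G₁))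
    + C A₁ * C A₂ * ((16 * (m : RPoly) + 20) * (32 * (n : RPoly) * ((n : RPoly) + 1) - 64 * (n : RPoly)) * C (genDelta a b d e f) * genL a b d e f ^ (m + n + 1)
        - (16 * (n : RPoly) + 20) * (32 * (m : RPoly) * ((m : RPoly) + 1) - 64 * (m : RPoly)) * C (genDelta a b d e f) * genL a b d e f ^ (m + n + 1)) * genW a b d e f, ?_⟩
  simp only [map_mul, map_add, map_sub, map_neg, map_natCast, map_ofNat, map_one, Nat.cast_add, Nat.cast_ofNat, pow_zero, pow_one,
    mul_one, zero_add] at f₁ f₂ c₁ c₂ bLM bLN d₁ d₂ k12 hexp g₁ g₂ ⊢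
  rw [bLM] at c₁
  rw [bLN] at c₂
  rw [d₁] at c₁
  rw [d₂] at c₂
  rw [detP_antisymm (genL a b d e f ^ n * genM a b d e f) (lapP G₁)] at hexp
  linear_combination ((16 * (m : RPoly) + 20) * (16 * (n : RPoly) + 20) * genL a b d e f ^ 3) * hexp
    + ((16 * (m : RPoly) + 20) * (16 * (n : RPoly) + 20) * C A₁ * C A₂ * genL a b d e f) * k12
    - (normSq * C A₁ * (16 * (m : RPoly) + 20) * genL a b d e f ^ 3) * g₁
    + (normSq * C A₂ * (16 * (n : RPoly) + 20) * genL a b d e f ^ 3) * g₂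
    - (normSq * C A₁ * (16 * (m : RPoly) + 20) * C A₂) * c₁
    + (normSq * C A₂ * (16 * (n : RPoly) + 20) * C A₁) * c₂

/-- `{−P, A} = −{P, A}`. [folklore] -/
theorem detP_neg_left (P A : RPoly) : detP (-P) A = -detP P A := by
  rw [detP_antisymm A (-P), detP_neg_right, detP_antisymm A P, neg_neg]

/-- `{M³, L} = −12 M² W`. [folklore] -/
theorem detP_genM_cube_genL : detP (genM a b d e f ^ 3) (genL a b d e f) = -(C 12 * genM a b d e f ^ 2 * genW a b d e f) := by
  rw [show genM a b d e f ^ 3 = genM a b d e f ^ 2 * genM a b d e f by ring, detP_mul_left, detP_genM_genL, detP_genM_sq_genL]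
  simp only [map_ofNat]
  ring

/-- ★ `{G_c, L}` to SECOND order for the remainder of the confined HARMONIC competitor `P_c′ = κ₀L^{k+3} + κ₁L^{k+2}M + ρG_c`
(`d₁ = 8k+22`, `d₂ = 16k+36`): `d₁d₂·L⁴{G_c,L} = d₂(16(k+3)(k+2)κ₀L^{k+5} + 32(k+2)(k+1)κ₁L^{k+4}M)W`
`− ρ(128(k+3)(k+2)(k+1)k·κ₀L^{k+3}M + 192(k+2)(k+1)k(k−1)·κ₁L^{k+2}M² + 96(k+2)(k+1)(2k+3)τ·κ₁L^{k+4})W + ρ²J`. [folklore] -/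
theorem exists_detP_genL_competitorRemainder₂ {Pc Gc : RPoly} {κ₀ κ₁ : ℝ} {k : ℕ} (hGc : Gc.IsHomogeneous (2 * k + 4))
    (hPc : Pc = C κ₀ * genL a b d e f ^ (k + 3) + C κ₁ * genL a b d e f ^ (k + 2) * genM a b d e f + normSq * Gc) (hl : lapP Pc = 0) :
    ∃ J : RPoly, C ((8 * (k : ℝ) + 22) * (16 * (k : ℝ) + 36)) * (genL a b d e f ^ 4 * detP Gc (genL a b d e f))
      = (16 * (k : RPoly) + 36) * (C (16 * ((k : ℝ) + 3) * ((k : ℝ) + 2) * κ₀) * genL a b d e f ^ (k + 5) * genW a b d e f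
          + C (32 * ((k : ℝ) + 2) * ((k : ℝ) + 1) * κ₁) * genL a b d e f ^ (k + 4) * genM a b d e f * genW a b d e f)
        - normSq * (C (128 * ((k : ℝ) + 3) * ((k : ℝ) + 2) * ((k : ℝ) + 1) * k * κ₀) * genL a b d e f ^ (k + 3) * genM a b d e f * genW a b d e f
          + C (192 * ((k : ℝ) + 2) * ((k : ℝ) + 1) * k * ((k : ℝ) - 1) * κ₁) * genL a b d e f ^ (k + 2) * genM a b d e f ^ 2 * genW a b d e f
          + C (96 * ((k : ℝ) + 2) * ((k : ℝ) + 1) * (2 * (k : ℝ) + 3) * genTau a b d e f * κ₁) * genL a b d e f ^ (k + 4) * genW a b d e f)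
        + normSq ^ 2 * J := by
  have r1 := congrArg (fun X => detP X (genL a b d e f)) (competitor_remainder a b d e f hGc hPc hl)
  have r2 := congrArg (fun X => detP X (genL a b d e f)) (competitor_lapP_remainder a b d e f hGc hPc hl)
  simp only [detP_sub_left, detP_neg_left, detP_C_mul_left, detP_normSq_mul_left'] at r1 r2
  -- first order
  have a1 : detP (lapP (genL a b d e f ^ (k + 3))) (genL a b d e f) = -(C (16 * ((k : ℝ) + 3) * ((k : ℝ) + 2)) * genL a b d e f ^ (k + 1) * genW a b d e f) := by
    rw [show k + 3 = k + 1 + 2 from rfl, lapP_genL_pow]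
    simp only [detP_mul_left, detP_C_left, detP_genL_pow_genL, detP_genM_genL, mul_zero, zero_mul, add_zero, zero_add]
    simp only [map_mul, map_add, map_natCast, map_ofNat, map_one, Nat.cast_add, Nat.cast_one]
    ring
  have a2 := genL_sq_mul_detP_lapP_genL_pow_mul_genM_genL a b d e f (k + 2)
  -- second order: brackets of the closed forms of `L³Δ²(L^{k+3})`, `L⁴Δ²(L^{k+2}M)` with `L`
  have b1 : detP (genL a b d e f ^ 3 * lapP (lapP (genL a b d e f ^ (k + 3)))) (genL a b d e f) = genL a b d e f ^ 3 * detP (lapP (lapP (genL a b d e f ^ (k + 3)))) (genL a b d e f) := by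
    rw [detP_mul_left, detP_genL_pow_genL, mul_zero, add_zero]
  have h3 := genL_cube_mul_lapP_lapP_genL_pow_succ a b d e f (k + 2)
  rw [show k + 2 + 1 = k + 3 from rfl] at h3
  rw [h3] at b1
  have b2 : detP (genL a b d e f ^ 4 * lapP (lapP (genL a b d e f ^ (k + 2) * genM a b d e f))) (genL a b d e f) = genL a b d e f ^ 4 * detP (lapP (lapP (genL a b d e f ^ (k + 2) * genM a b d e f))) (genL a b d e f) := by
    rw [detP_mul_left, detP_genL_pow_genL, mul_zero, add_zero]
  rw [genL_pow_four_mul_lapP_lapP_genL_pow_mul_genM] at b2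
  simp only [detP_add_left, detP_mul_left, detP_C_left, detP_genL_pow_genL, detP_genM_genL, detP_genM_sq_genL, detP_genM_cube_genL,
    detP_normSq_left, mul_zero, zero_mul, add_zero, zero_add] at b1 b2
  refine ⟨genL a b d e f ^ 4 * detP (lapP (lapP Gc)) (genL a b d e f)
      - C (384 * ((k : ℝ) + 2) * ((k : ℝ) + 1) * k * genDelta a b d e f * κ₁) * genL a b d e f ^ (k + 3) * genW a b d e f, ?_⟩
  simp only [map_mul, map_add, map_sub, map_neg, map_natCast, map_ofNat, map_one, Nat.cast_add, Nat.cast_ofNat, Nat.cast_one] at r1 r2 a1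
  simp only [map_mul, map_add, map_sub, map_neg, map_natCast, map_ofNat, map_one, Nat.cast_add, Nat.cast_ofNat, Nat.cast_one] at a2 b1 b2 ⊢
  linear_combination ((16 * (k : RPoly) + 36) * genL a b d e f ^ 4) * r1 - (normSq * genL a b d e f ^ 4) * r2
    - ((16 * (k : RPoly) + 36) * C κ₀ * genL a b d e f ^ 4) * a1 - ((16 * (k : RPoly) + 36) * C κ₁ * genL a b d e f ^ 2) * a2
    - (normSq * C κ₀ * genL a b d e f) * b1 - (normSq * C κ₁) * b2

/-- `{P_c′, P_{D′}}` to SECOND order for the confined harmonic competitor and the second shell `P_{D′} = g₁L^{k+4} + ρG₁`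
(`q₁ = 8k+30`, `d₁ = 8k+22`): `q₁d₁·L²{P_c′,P_{D′}} = −4(k+4)q₁d₁κ₁g₁·L^{2k+7}W`
`+ ρ(q₁g₁(k+4)(16(k+3)(k+2)κ₀L^{2k+6} + 32(k+2)(k+1)κ₁L^{2k+5}M) + 4(k+3)d₁A₁κ₀L^{2k+6})W + ρ²J`. [folklore] -/
theorem exists_detP_competitor_top₂ {Pc Gc P₁ G₁ : RPoly} {κ₀ κ₁ g₁ A₁ : ℝ} {k : ℕ} (hGc : Gc.IsHomogeneous (2 * k + 4))
    (hPc : Pc = C κ₀ * genL a b d e f ^ (k + 3) + C κ₁ * genL a b d e f ^ (k + 2) * genM a b d e f + normSq * Gc) (hl : lapP Pc = 0)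
    (hP₁ : P₁ = C g₁ * genL a b d e f ^ (k + 4) + normSq * G₁)
    (h₁ : C (8 * (k : ℝ) + 30) * G₁ = C A₁ * genL a b d e f ^ (k + 2) * genM a b d e f - normSq * lapP G₁) :
    ∃ J : RPoly, C ((8 * (k : ℝ) + 30) * (8 * (k : ℝ) + 22)) * (genL a b d e f ^ 2 * detP Pc P₁)
      = -(C (4 * ((k : ℝ) + 4) * (8 * (k : ℝ) + 30) * (8 * (k : ℝ) + 22) * κ₁ * g₁) * genL a b d e f ^ (2 * k + 7) * genW a b d e f)
        + normSq * ((8 * (k : RPoly) + 30) * C g₁ * ((k : RPoly) + 4)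
              * (C (16 * ((k : ℝ) + 3) * ((k : ℝ) + 2) * κ₀) * genL a b d e f ^ (2 * k + 6) * genW a b d e f
                + C (32 * ((k : ℝ) + 2) * ((k : ℝ) + 1) * κ₁) * genL a b d e f ^ (2 * k + 5) * genM a b d e f * genW a b d e f)
            + C (4 * ((k : ℝ) + 3) * (8 * (k : ℝ) + 22) * A₁ * κ₀) * genL a b d e f ^ (2 * k + 6) * genW a b d e f)
        + normSq ^ 2 * J := by
  -- `{P_c′, P₁} = g₁(k+4)L^{k+3}{P_c′, L} + ρ{P_c′, G₁}`, `{P_c′, L} = {E_c, L} + ρ{G_c, L}`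
  have s0 := detP_genShell_right a b d e f Pc hP₁
  have t1 := exists_detP_genL_competitorRemainder a b d e f hGc hPc hl     -- d₁L²{G_c,L} mod ρ
  obtain ⟨J₁, hJ₁⟩ := t1
  have hEcL : detP Pc (genL a b d e f) = -(C (4 * κ₁) * genL a b d e f ^ (k + 2) * genW a b d e f) + normSq * detP Gc (genL a b d e f) := by
    rw [hPc, detP_add_left, detP_add_left, detP_C_mul_left, detP_genL_pow_genL, show C κ₁ * genL a b d e f ^ (k + 2) * genM a b d e f
      = C κ₁ * (genL a b d e f ^ (k + 2) * genM a b d e f) by ring, detP_C_mul_left, detP_genL_pow_mul_genM_genL, detP_normSq_mul_genL]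
    simp only [map_mul, map_ofNat]; ring
  -- `{P_c′, G₁}` mod ρ: `q₁{P_c′,G₁} = A₁{P_c′, L^{k+2}M} − ρ{P_c′, ΔG₁}` and `{E_c, L^{k+2}M} = κ₀{L^{k+3}, L^{k+2}M}`
  have g1 := congrArg (detP Pc) h₁
  rw [detP_C_mul_right, detP_sub_right, show C A₁ * genL a b d e f ^ (k + 2) * genM a b d e f = C A₁ * (genL a b d e f ^ (k + 2) * genM a b d e f) by ring, detP_C_mul_right,
    detP_normSq_mul_right'] at g1
  have hEcX : detP Pc (genL a b d e f ^ (k + 2) * genM a b d e f) = C (4 * ((k : ℝ) + 3) * κ₀) * genL a b d e f ^ (2 * k + 4) * genW a b d e f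
      + normSq * detP Gc (genL a b d e f ^ (k + 2) * genM a b d e f) := by
    rw [hPc, detP_add_left, detP_add_left, detP_C_mul_left, show k + 3 = k + 2 + 1 from rfl, detP_genL_pow_succ_genL_pow_mul_genM,
      show C κ₁ * genL a b d e f ^ (k + 2) * genM a b d e f = C κ₁ * (genL a b d e f ^ (k + 2) * genM a b d e f) by ring, detP_C_mul_left, detP_self, detP_normSq_mul_left',
      show k + 2 + (k + 2) = 2 * k + 4 by ring]
    simp only [map_mul, map_add, map_one, map_natCast, map_ofNat, Nat.cast_add, Nat.cast_ofNat, Nat.cast_one]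
    ring
  refine ⟨(8 * (k : RPoly) + 30) * C g₁ * ((k : RPoly) + 4) * genL a b d e f ^ (k + 3) * J₁
      + (8 * (k : RPoly) + 22) * genL a b d e f ^ 2 * (C A₁ * detP Gc (genL a b d e f ^ (k + 2) * genM a b d e f) - detP Pc (lapP G₁)), ?_⟩
  rw [hEcL] at s0
  rw [hEcX] at g1
  simp only [map_mul, map_add, map_sub, map_neg, map_natCast, map_ofNat, map_one, Nat.cast_add, Nat.cast_ofNat, Nat.cast_one] at s0 hJ₁ g1 ⊢
  linear_combination ((8 * (k : RPoly) + 30) * (8 * (k : RPoly) + 22) * genL a b d e f ^ 2) * s0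
    + ((8 * (k : RPoly) + 30) * C g₁ * ((k : RPoly) + 4) * normSq * genL a b d e f ^ (k + 3)) * hJ₁
    + ((8 * (k : RPoly) + 22) * normSq * genL a b d e f ^ 2) * g1

/-- The bracket of the confined `D′ − 4` shell's explicit part with `L`: `{a₀L^kM² + b₀L^{k+1}M + γL^{k+2}, L} = −8a₀L^kMW − 4b₀L^{k+1}W`.
[folklore] -/
theorem detP_bShell_genL (a₀ b₀ γ : ℝ) (k : ℕ) :
    detP (C a₀ * genL a b d e f ^ k * genM a b d e f ^ 2 + C b₀ * genL a b d e f ^ (k + 1) * genM a b d e f + C γ * genL a b d e f ^ (k + 2)) (genL a b d e f)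
      = -(C (8 * a₀) * genL a b d e f ^ k * genM a b d e f * genW a b d e f) - C (4 * b₀) * genL a b d e f ^ (k + 1) * genW a b d e f := by
  simp only [detP_add_left, detP_mul_left, detP_C_left, detP_genL_pow_genL, detP_genM_genL, detP_genM_sq_genL, mul_zero, zero_mul,
    add_zero, zero_add]
  simp only [map_mul, map_ofNat]
  ring

/-- ★ `{G_b, L}` modulo `ρ` for the remainder of the confined HARMONIC `D′ − 4` shell `P_b′ = a₀L^kM² + b₀L^{k+1}M + γL^{k+2} + ρG_b`
(`p_b = 8k+14`): `p_b·L²{G_b,L} = (48k(k−1)a₀L^kM² + 32(k+1)τa₀L^{k+2} + 32k(k+1)b₀L^{k+1}M + 16(k+2)(k+1)γL^{k+2})W + ρJ`. [folklore] -/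
theorem exists_detP_genL_bShellRemainder {Pb Gb : RPoly} {a₀ b₀ γ : ℝ} {k : ℕ} (hGb : Gb.IsHomogeneous (2 * k + 2))
    (hPb : Pb = C a₀ * genL a b d e f ^ k * genM a b d e f ^ 2 + C b₀ * genL a b d e f ^ (k + 1) * genM a b d e f + C γ * genL a b d e f ^ (k + 2) + normSq * Gb) (hl : lapP Pb = 0) :
    ∃ J : RPoly, C (8 * (k : ℝ) + 14) * (genL a b d e f ^ 2 * detP Gb (genL a b d e f))
      = (C (48 * (k : ℝ) * ((k : ℝ) - 1) * a₀) * genL a b d e f ^ k * genM a b d e f ^ 2 + C (32 * ((k : ℝ) + 1) * genTau a b d e f * a₀) * genL a b d e f ^ (k + 2)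
          + C (32 * (k : ℝ) * ((k : ℝ) + 1) * b₀) * genL a b d e f ^ (k + 1) * genM a b d e f + C (16 * ((k : ℝ) + 2) * ((k : ℝ) + 1) * γ) * genL a b d e f ^ (k + 2)) * genW a b d e f
        + normSq * J := by
  have r := congrArg (fun X => detP X (genL a b d e f)) (bShell_remainder a b d e f hGb hPb hl)
  simp only [detP_sub_left, detP_neg_left, detP_C_mul_left, detP_normSq_mul_left'] at r
  -- brackets of the closed forms `L²Δ(L^kM²)`, `L²Δ(L^{k+1}M)`, `L²Δ(L^{k+2})` with `L`
  have b1 : detP (genL a b d e f ^ 2 * lapP (genL a b d e f ^ k * genM a b d e f ^ 2)) (genL a b d e f) = genL a b d e f ^ 2 * detP (lapP (genL a b d e f ^ k * genM a b d e f ^ 2)) (genL a b d e f) := by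
    rw [detP_mul_left, detP_genL_pow_genL, mul_zero, add_zero]
  rw [genL_sq_mul_lapP_genL_pow_mul_genM_sq] at b1
  have b2 := genL_sq_mul_detP_lapP_genL_pow_mul_genM_genL a b d e f (k + 1)
  have b3 : detP (genL a b d e f ^ 2 * lapP (genL a b d e f ^ (k + 2))) (genL a b d e f) = genL a b d e f ^ 2 * detP (lapP (genL a b d e f ^ (k + 2))) (genL a b d e f) := by
    rw [detP_mul_left, detP_genL_pow_genL, mul_zero, add_zero]
  rw [genL_sq_mul_lapP_genL_pow] at b3
  simp only [detP_add_left, detP_mul_left, detP_C_left, detP_genL_pow_genL, detP_genM_genL, detP_genM_sq_genL, detP_genM_cube_genL,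
    detP_normSq_left, mul_zero, zero_mul, add_zero, zero_add] at b1 b3
  refine ⟨-(genL a b d e f ^ 2 * detP (lapP Gb) (genL a b d e f)) + C (64 * (k : ℝ) * genDelta a b d e f * a₀) * genL a b d e f ^ (k + 1) * genW a b d e f, ?_⟩
  simp only [map_mul, map_add, map_sub, map_neg, map_natCast, map_ofNat, map_one, Nat.cast_add, Nat.cast_ofNat, Nat.cast_one] at r b1 b2
  simp only [map_mul, map_add, map_sub, map_neg, map_natCast, map_ofNat, map_one, Nat.cast_add, Nat.cast_ofNat, Nat.cast_one] at b3 ⊢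
  linear_combination genL a b d e f ^ 2 * r + C a₀ * b1 - C b₀ * b2 + C γ * b3

/-- ★ `{P_b′, G₂}` modulo `ρ` for the confined `D′−4` shell and a top remainder `(8n+14)G₂ = A₂L^nM − ρΔG₂`:
`q₂·L{P_b′,G₂} = A₂(4(k−2n)a₀L^{k+n}M² + 4(k+1−n)b₀L^{k+n+1}M + 4(k+2)γL^{k+n+2})W + ρJ`. [folklore] -/
theorem exists_detP_bShell_remainder {Pb Gb G₂ : RPoly} {a₀ b₀ γ A₂ : ℝ} {k n : ℕ}
    (hPb : Pb = C a₀ * genL a b d e f ^ k * genM a b d e f ^ 2 + C b₀ * genL a b d e f ^ (k + 1) * genM a b d e f + C γ * genL a b d e f ^ (k + 2) + normSq * Gb)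
    (h₂ : C (8 * (n : ℝ) + 14) * G₂ = C A₂ * genL a b d e f ^ n * genM a b d e f - normSq * lapP G₂) :
    ∃ J : RPoly, C (8 * (n : ℝ) + 14) * (genL a b d e f * detP Pb G₂)
      = C A₂ * (C (4 * ((k : ℝ) - 2 * n) * a₀) * genL a b d e f ^ (k + n) * genM a b d e f ^ 2 + C (4 * ((k : ℝ) + 1 - n) * b₀) * genL a b d e f ^ (k + n + 1) * genM a b d e f
          + C (4 * ((k : ℝ) + 2) * γ) * genL a b d e f ^ (k + n + 2)) * genW a b d e f
        + normSq * J := by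
  have g := congrArg (detP Pb) h₂
  rw [detP_C_mul_right, detP_sub_right, show C A₂ * genL a b d e f ^ n * genM a b d e f = C A₂ * (genL a b d e f ^ n * genM a b d e f ^ (0 + 1)) by ring, detP_C_mul_right,
    detP_normSq_mul_right'] at g
  have hx : genL a b d e f * detP Pb (genL a b d e f ^ n * genM a b d e f ^ (0 + 1))
      = C a₀ * (genL a b d e f * detP (genL a b d e f ^ k * genM a b d e f ^ (1 + 1)) (genL a b d e f ^ n * genM a b d e f ^ (0 + 1)))
        + C b₀ * (genL a b d e f * detP (genL a b d e f ^ (k + 1) * genM a b d e f ^ (0 + 1)) (genL a b d e f ^ n * genM a b d e f ^ (0 + 1)))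
        + C γ * (genL a b d e f * detP (genL a b d e f ^ (k + 2)) (genL a b d e f ^ n * genM a b d e f ^ (0 + 1)))
        + normSq * (genL a b d e f * detP Gb (genL a b d e f ^ n * genM a b d e f ^ (0 + 1))) := by
    rw [hPb, detP_add_left, detP_add_left, detP_add_left, show C a₀ * genL a b d e f ^ k * genM a b d e f ^ 2 = C a₀ * (genL a b d e f ^ k * genM a b d e f ^ (1 + 1)) by ring,
      detP_C_mul_left, show C b₀ * genL a b d e f ^ (k + 1) * genM a b d e f = C b₀ * (genL a b d e f ^ (k + 1) * genM a b d e f ^ (0 + 1)) by ring, detP_C_mul_left, detP_C_mul_left,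
      detP_normSq_mul_left']
    ring
  rw [genL_mul_detP_genL_pow_mul_genM_pow, genL_mul_detP_genL_pow_mul_genM_pow, genL_mul_detP_genL_pow_genL_pow_mul_genM_pow] at hx
  refine ⟨genL a b d e f * (C A₂ * detP Gb (genL a b d e f ^ n * genM a b d e f ^ (0 + 1)) - detP Pb (lapP G₂)), ?_⟩
  simp only [map_mul, map_add, map_sub, map_natCast, map_ofNat, map_one, Nat.cast_add, Nat.cast_ofNat, Nat.cast_one, zero_add, pow_one,
    pow_zero, mul_one] at g hx ⊢
  linear_combination genL a b d e f * g + C A₂ * hx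

end Real

end Summit.NavierStokesRegularity.NavierStokesRegularity.Theorems.PoloidalLiouville.HorizonTower.Zonal

end
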